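import Mathlib.Geometry.Manifold.Instances.Sphere
import Mathlib.Geometry.Manifold.Diffeomorph
import Mathlib.AlgebraicTopology.FundamentalGroupoid.SimplyConnected
import Mathlib.Topology.Homotopy.Equiv
import Mathlib.Algebra.Category.ModuleCat.Basic
import Literature.Topology.FourManifolds.SPC4Wave0
import Literature.Topology.FourManifolds.SphereSimplyConnected
import HarnessLib

/-!
# Barrier (SmoothPoincare4): the `b₂`-graded strengthening fails from `b₂ = 3` on (small exotic 4-manifolds)

Barrier catalogue `Literature/Barriers/SmoothPoincare4/` (D-0021), entry for the technique class
**"prove that homeomorphic simply connected closed smooth 4-manifolds with small `b₂` are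
diffeomorphic"** by a method that does not use `b₂ ≤ 2` — `SmoothPoincare4` is contained in the
case `b₂ = 0` of the graded family of statements `SimplyConnectedRigidityUpTo k` (`H₂ ≅ ℤʲ`,
`j ≤ k`), and that family is false for every `k ≥ 3`.

AUDIT 2026-08-16 (barrier-audit; companion `SmallExoticaFrontierNarrow.lean`) — the STATEMENT is
confirmed (Akhmedov–Park 2010, Thm. 1 (i), arXiv p. 3; the `b₂ = 3` frontier still stands in print
[cite: LevineLidmanPiccirillo2023, §1 p. 1] [cite: StipsiczSzabo2024, §1]); the TECHNIQUE CLASS is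
narrowed to TYPE-BLIND graded rigidity: `SmoothPoincare4` is the `k = 0` case of EVERY family
`SimplyConnectedRigidityUpToOn P k` refined by a property `P` of the model manifold that `S⁴` has
(companion, `SimplyConnectedRigidityUpToOn.nonempty_diffeomorph_sphere`), and the Akhmedov–Park
witnesses refute such a family only for `P` reached by the homeomorphism type of `ℂℙ² # 2ℂℙ²bar`
(odd indefinite form `I₊ ⊕ 2I₋`, `σ = ∓1`; companion, `not_simplyConnectedRigidityUpToOn_of_lemma8`).
The refinements by even type, signature zero and definiteness are untouched at every `k`; their
printed frontiers are `b₂ = 22`, `b₂ = 18` and NONE [cite: BaykurHamada2023, Thm. A]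
[cite: StipsiczSzabo2024, §1] — see evasions_known and scope_caveats (d) below.

## What is printed

* Akhmedov–Park 2010 (Invent. Math. 181; arXiv:math/0701829), Thm. 1: "Let `M` be one of the
  following 4-manifolds. (i) `ℂℙ² # m ℂℙ²bar` for `m = 2, 4`, (ii) `3ℂℙ² # k ℂℙ²bar` for
  `k = 4, 6, 8, 10`, (iii) `(2n-1)ℂℙ² # 2n ℂℙ²bar` for any integer `n ≥ 3`. Then there exist an
  irreducible symplectic 4-manifold and an infinite family of pairwise non-diffeomorphic
  irreducible non-symplectic 4-manifolds, all of which are homeomorphic to `M`."; §1: "Currently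
  `ℂℙ² # 2ℂℙ²bar` has the smallest Euler characteristic amongst all simply-connected topological
  4-manifolds that are known to possess more than one smooth structure." (`e = 5`, `σ = -1`,
  `b₂ = 3`, Lemma 8); proof of Lemma 8: `X₁(m)` is "'reverse-engineered' from
  `(Σ₂ × T²) #_ψ (T⁴ # ℂℙ²bar)`", "a minimal symplectic 4-manifold with `b₂⁺ > 1`", by "5
  Luttinger surgeries and a single `m` torus surgery", and "We can then compute the
  Seiberg-Witten invariants of `X₁(m)` and check that infinitely many of them are distinct ...
  using the product formulas in [MMS]".
* Donaldson 1987 (tree: `Literature.Topology.FourManifolds.exists_isHCobordant_isEmpty_diffeomorph_four`): `ℂℙ² # 9ℂℙ²bar`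
  and the Dolgachev surface, `b₂ = 10`, are homeomorphic (h-cobordant) and not diffeomorphic —
  the first failure of the family.
* Freedman 1982, Thm. 1.6 (tree: `Literature.Topology.FourManifolds.nonempty_homeomorph_sphere_four`, spc4.S04): a homotopy
  4-sphere is homeomorphic to `S⁴`; Freedman–Quinn §10 (tree: `Literature.Topology.FourManifolds.nonempty_homotopyEquiv_sphere_four_iff`,
  spc4.S10): a closed 4-manifold is `≃ₕ S⁴` iff `π₁ = 1` and `H₂(·; ℤ) = 0`.

## How it is rendered here (relative to the tree's notions, D-0014)

* `SimplyConnectedRigidityUpTo k` — the graded family, explicit: homeomorphic simply connected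
  closed smooth 4-manifolds `M`, `N` with `H₂(M; ℤ) ≅ ℤʲ` for some `j ≤ k` (the tree's
  `Literature.SPC4.singularHomologyZ M 2`) are diffeomorphic; antitone in `k`
  (`SimplyConnectedRigidityUpTo.anti`). PROVED: the case `k = 0` already yields the smooth Poincaré
  statement — every closed smooth 4-manifold `≃ₕ S⁴` is `≅ S⁴` — GIVEN Freedman's theorem and
  the `π₁`/`H₂` characterisation of homotopy 4-spheres (tree facts, hypotheses), and the tree's
  proved `π₁(S⁴) = 1` (`SimplyConnectedRigidityUpTo.nonempty_diffeomorph_sphere`). The cases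
  `k = 1, 2` contain the open `ℂℙ²`, `S² × S²`, `ℂℙ² # ℂℙ²bar` problems (tree
  `Literature.Topology.FourManifolds.NoExoticComplexProjectivePlaneConjecture`, `NoExoticSphereTwoProdConjecture`).
* `akhmedovPark2010_exotic_bTwo_three` — named fact: a simply connected closed smooth 4-manifold
  with `H₂ ≅ ℤ³` and infinitely many pairwise non-diffeomorphic closed smooth 4-manifolds
  homeomorphic to it (Thm. 1 (i), `m = 2`, with the identification of the model as `ℂℙ² # 2ℂℙ²bar`
  weakened to `H₂ ≅ ℤ³`).
* `SmallExoticaBarrier := ¬ SimplyConnectedRigidityUpTo 3` — PROVED from the fact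
  (`smallExoticaBarrier_of_akhmedovPark`), hence `¬ SimplyConnectedRigidityUpTo k` for all
  `k ≥ 3` (`not_simplyConnectedRigidityUpTo_of_three_le`).

## References

[AkhmedovPark2010] [DonaldsonIrrationality1987] [FreedmanJDG1982] [FreedmanQuinnPMS1990]
[HatcherAT2002] [BaykurHamada2023] [StipsiczSzabo2024] [LevineLidmanPiccirillo2023]
[AkhmedovPark2010S2xS2]
-/

noncomputable section

open scoped Manifold ContDiff
open CategoryTheory ContinuousMap

namespace Literature.Barriers.SmoothPoincare4

/-- Local notation: `𝔼 n` is the model Euclidean space `EuclideanSpace ℝ (Fin n)`. -/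
local notation "𝔼 " n:arg => EuclideanSpace ℝ (Fin n)

/-- Local notation: `𝕊 n` is the unit sphere in `EuclideanSpace ℝ (Fin (n + 1))`, the standard
`n`-sphere with its Mathlib manifold structure. -/
local notation "𝕊 " n:arg => (Metric.sphere (0 : EuclideanSpace ℝ (Fin (n + 1))) 1)

/-! ### The graded family of strengthenings -/

/-- **`H₂(M; ℤ)` is free of rank at most `k`**: for some `j ≤ k`, `H₂(M; ℤ) ≅ ℤʲ` as `ℤ`-modules
(the tree's `Literature.SPC4.singularHomologyZ M 2`). For simply connected closed 4-manifolds `H₂` is free,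
so this is `b₂(M) ≤ k`. [folklore] -/
def HasSecondHomologyRankLE (k : ℕ) (M : Type) [TopologicalSpace M] : Prop :=
  ∃ j ≤ k, Nonempty (Literature.Topology.FourManifolds.singularHomologyZ M 2 ≅ ModuleCat.of ℤ (Fin j → ℤ))

/-- Monotonicity of the rank bound. [folklore] -/
theorem HasSecondHomologyRankLE.mono {j k : ℕ} (hjk : j ≤ k) {M : Type} [TopologicalSpace M]
    (h : HasSecondHomologyRankLE j M) : HasSecondHomologyRankLE k M := by
  obtain ⟨i, hi, e⟩ := h
  exact ⟨i, hi.trans hjk, e⟩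

/-- `H₂ = 0` gives rank `≤ 0` (`ℤ⁰ = 0`). [folklore] -/
theorem hasSecondHomologyRankLE_zero_of_isZero {M : Type} [TopologicalSpace M]
    (h : Limits.IsZero (Literature.Topology.FourManifolds.singularHomologyZ M 2)) : HasSecondHomologyRankLE 0 M :=
  ⟨0, le_rfl, ⟨h.iso (ModuleCat.isZero_of_subsingleton _)⟩⟩

/-- **`b₂`-graded smooth rigidity of simply connected closed 4-manifolds.** For `k : ℕ`: whenever
`M`, `N` are simply connected closed smooth 4-manifolds (Hausdorff, second countable, compact,
`C^∞` on `ℝ⁴`, in `Type`) with `H₂(M; ℤ) ≅ ℤʲ`, `j ≤ k` (`HasSecondHomologyRankLE k M`), and `M` is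
homeomorphic to `N`, then `M` is diffeomorphic to `N`. The case `k = 0` yields the smooth
Poincaré statement given Freedman (`SimplyConnectedRigidityUpTo.nonempty_diffeomorph_sphere`); the
family is FALSE for every `k ≥ 3` (`not_simplyConnectedRigidityUpTo_of_three_le`).
[cite: AkhmedovPark2010, Thm. 1 and §1] [cite: FreedmanJDG1982, Thm. 1.6] -/
def SimplyConnectedRigidityUpTo (k : ℕ) : Prop :=
  ∀ (M N : Type) [TopologicalSpace M] [T2Space M] [SecondCountableTopology M]
    [ChartedSpace (𝔼 4) M] [IsManifold (𝓡 4) ∞ M] [CompactSpace M] [SimplyConnectedSpace M]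
    [TopologicalSpace N] [T2Space N] [SecondCountableTopology N]
    [ChartedSpace (𝔼 4) N] [IsManifold (𝓡 4) ∞ N] [CompactSpace N] [SimplyConnectedSpace N],
    HasSecondHomologyRankLE k M → Nonempty (M ≃ₜ N) → Nonempty (M ≃ₘ⟮𝓡 4, 𝓡 4⟯ N)

/-- The family is antitone: rigidity up to `k` implies rigidity up to any `j ≤ k`. [folklore] -/
theorem SimplyConnectedRigidityUpTo.anti {j k : ℕ} (hjk : j ≤ k) (h : SimplyConnectedRigidityUpTo k) :
    SimplyConnectedRigidityUpTo j :=
  fun M N _ _ _ _ _ _ _ _ _ _ _ _ _ _ hb hMN => h M N (hb.mono hjk) hMN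

/-- **The case `k = 0` already yields the smooth Poincaré statement**, GIVEN Freedman's theorem
(tree fact `Literature.Topology.FourManifolds.nonempty_homeomorph_sphere_four`, hypothesis `hF`) and the characterisation
of homotopy 4-spheres by `π₁ = 1`, `H₂ = 0` (tree fact `Literature.Topology.FourManifolds.nonempty_homotopyEquiv_sphere_four_iff`,
hypothesis `hS10`), with `π₁(S⁴) = 1` proved in the tree (`Literature.Topology.FourManifolds.simplyConnectedSpace_sphere_four_holds`):
for every closed smooth 4-manifold `M ≃ₕ S⁴`, apply rigidity to the pair `(M, S⁴)` — `M` is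
simply connected with `H₂(M; ℤ) = 0`, and homeomorphic to `S⁴`. This is the precise sense in which
`SmoothPoincare4` is the bottom of the graded family (pattern of
`HCobordismPrincipleFour.nonempty_diffeomorph_sphere` in `HCobordismTheoremFails.lean`).
[cite: FreedmanJDG1982, Thm. 1.6] [cite: FreedmanQuinnPMS1990, §10] -/
theorem SimplyConnectedRigidityUpTo.nonempty_diffeomorph_sphere (h : SimplyConnectedRigidityUpTo 0)
    (hF : Literature.Topology.FourManifolds.nonempty_homeomorph_sphere_four.{0})
    (hS10 : Literature.Topology.FourManifolds.nonempty_homotopyEquiv_sphere_four_iff.{0})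
    (M : Type) [TopologicalSpace M] [T2Space M] [SecondCountableTopology M]
    [ChartedSpace (𝔼 4) M] [IsManifold (𝓡 4) ∞ M] [CompactSpace M] (e : M ≃ₕ 𝕊 4) :
    Nonempty (M ≃ₘ⟮𝓡 4, 𝓡 4⟯ (𝕊 4)) := by
  haveI : SimplyConnectedSpace (𝕊 4) := Literature.Topology.FourManifolds.simplyConnectedSpace_sphere_four_holds
  haveI : SimplyConnectedSpace M := e.simplyConnectedSpace
  have hZ : Limits.IsZero (Literature.Topology.FourManifolds.singularHomologyZ M 2) := ((hS10 M).1 ⟨e⟩).2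
  exact h M (𝕊 4) (hasSecondHomologyRankLE_zero_of_isZero hZ) (hF M e)

/-! ### Akhmedov–Park: exotic structures at `b₂ = 3` -/

/-- **Akhmedov–Park 2010, Thm. 1 (i), `m = 2` (named fact, weakened: the model manifold
`ℂℙ² # 2ℂℙ²bar` is recorded only through `H₂ ≅ ℤ³`).** There are a simply connected closed smooth
4-manifold `M` with `H₂(M; ℤ) ≅ ℤ³` and a sequence `N₀, N₁, …` of closed smooth 4-manifolds, each
homeomorphic to `M`, which are pairwise non-diffeomorphic ("an infinite family of pairwise
non-diffeomorphic irreducible non-symplectic 4-manifolds, all of which are homeomorphic to `M`",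
`M = ℂℙ² # 2ℂℙ²bar`, simply connected with `H₂ ≅ ℤ³`). Irreducibility and the symplectic member are
not rendered. Users take `(h : akhmedovPark2010_exotic_bTwo_three)`.
[cite: AkhmedovPark2010, Thm. 1 (i) and Lemma 8] -/
def akhmedovPark2010_exotic_bTwo_three : Prop :=
  ∃ (M : Type) (_ : TopologicalSpace M) (_ : T2Space M) (_ : SecondCountableTopology M)
    (_ : ChartedSpace (𝔼 4) M) (_ : IsManifold (𝓡 4) ∞ M) (_ : CompactSpace M)
    (_ : SimplyConnectedSpace M)
    (N : ℕ → Type) (_ : ∀ i, TopologicalSpace (N i)) (_ : ∀ i, T2Space (N i))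
    (_ : ∀ i, SecondCountableTopology (N i)) (_ : ∀ i, ChartedSpace (𝔼 4) (N i))
    (_ : ∀ i, IsManifold (𝓡 4) ∞ (N i)) (_ : ∀ i, CompactSpace (N i)),
    Nonempty (Literature.Topology.FourManifolds.singularHomologyZ M 2 ≅ ModuleCat.of ℤ (Fin 3 → ℤ)) ∧
      (∀ i, Nonempty (N i ≃ₜ M)) ∧ ∀ i j, Nonempty (N i ≃ₘ⟮𝓡 4, 𝓡 4⟯ N j) → i = j

/-! ### The barrier -/

/-- **Barrier (named statement): `b₂`-graded rigidity already fails at `b₂ = 3`**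
(`¬ SimplyConnectedRigidityUpTo 3`): there are homeomorphic, non-diffeomorphic simply connected
closed smooth 4-manifolds with `H₂ ≅ ℤ³`. PROVED below from the Akhmedov–Park fact
(`smallExoticaBarrier_of_akhmedovPark`).

BARRIER (D-0021), one line per key:
* technique_class: arguments deriving diffeomorphism from homeomorphism for simply connected closed smooth 4-manifolds with small second Betti number WITHOUT using `b₂ ≤ 2` — formally any proof of `SimplyConnectedRigidityUpTo k` for some `k ≥ 3`, which by `SimplyConnectedRigidityUpTo.anti` and `SimplyConnectedRigidityUpTo.nonempty_diffeomorph_sphere` would prove `SmoothPoincare4` (given Freedman's theorem [cite: FreedmanJDG1982, Thm. 1.6] and the `π₁`/`H₂` characterisation of homotopy 4-spheres [cite: FreedmanQuinnPMS1990, §10]) [cite: AkhmedovPark2010, §1]. AUDIT 2026-08-16: TYPE-BLIND arguments only — an argument whose hypotheses on the model manifold fail for every smooth structure on the topological `ℂℙ² # 2ℂℙ²bar` (odd indefinite form, `σ = ∓1` [cite: AkhmedovPark2010, Thm. 2 and proof of Lemma 8]) is NOT in the class, however insensitive to `b₂ ≤ 2` it is; see evasions_known (ii) and the companion `SmallEx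oticaFrontierNarrow.lean`.
* blocks: the natural `b₂`-graded strengthenings of `SmoothPoincare4`, `SimplyConnectedRigidityUpTo k` for all `k ≥ 3` [cite: AkhmedovPark2010, Thm. 1 (i)]; historically first `k ≥ 10` [cite: DonaldsonIrrationality1987, Thm. (3.24)].
* because: Luttinger surgeries and one torus surgery on a minimal symplectic model with `b₂⁺ > 1` ("reverse engineering" from `(Σ₂ × T²) #_ψ (T⁴ # ℂℙ²bar)`) produce, in the homeomorphism type of `ℂℙ² # 2ℂℙ²bar` (`e = 5`, `σ = -1`), infinitely many manifolds whose Seiberg–Witten invariants, computed by product formulas, are pairwise distinct [cite: AkhmedovPark2010, Lemma 8 and its proof]; the homeomorphism type is identified by Freedman's classification [cite: FreedmanJDG1982, Thm. 1.5].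
* evasions_known: (i) none below `b₂ = 3`: "`ℂℙ² # 2ℂℙ²bar` has the smallest Euler characteristic amongst all simply-connected topological 4-manifolds that are known to possess more than one smooth structure" [cite: AkhmedovPark2010, §1], still so in print in 2023–2024 ("stalled for the ensuing years due to a lack of examples" [cite: LevineLidmanPiccirillo2023, §1 p. 1]; "even the existence of an exotic `S² × S²` is unknown" [cite: StipsiczSzabo2024, §1]; the unrefereed 2010 claim of exotic `S² × S²` [cite: AkhmedovPark2010S2xS2, Thm. 3] would only strengthen the barrier to `k ≥ 2`); the cases `b₂ ≤ 2` (`S⁴`, `ℂℙ²`, `S² × S²`, `ℂℙ² # ℂℙ²bar`, `ℂℙ² # ℂℙ²`) are open, and at `b₂ = 0` the Seiberg–Witten invariants used at `b₂ = 3` are unavailable (sibling entry `GaugeInvariantsBlind.lean`); (ii) AUDIT 2026-08-16 — TYPE-SENSITIVE graded rigidity evades the barrier at every `k`: the refined families `SimplyConnectedRigidityUpToOn P k` (companion) with `P` = even type, signature zero, or definite type all contain `SmoothPoincare4` as their `k = 0` case (`S⁴`: form `0`) and are not reached by any Akhmedov–Park witness (form `I₊ ⊕ 2I₋`: odd, `σ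 = −1`, indefinite — proved in the companion); their first KNOWN failures are `b₂ = 22` (`#₁₁(S² × S²)` [cite: BaykurHamada2023, Thm. A], homotopy K3's [cite: FintushelStern2009, Lecture 4 §15 Thm. 4]), `b₂ = 18` (`#₉(ℂℙ² # ℂℙ²bar)`, "the smallest exotic closed simply connected 4-manifolds with signature zero known to date" [cite: BaykurHamada2023, Abstract and Thm. A]) and NONE ("no closed simply connected definite smooth four-manifold with an exotic smooth structure is known" [cite: StipsiczSzabo2024, §1]; exotic definite closed 4-manifolds are known only with `π₁ ≠ 1` — `π₁ = ℤ/2` in [cite: LevineLidmanPiccirillo2023, Thm. 1.2] [cite: StipsiczSzabo2024, Thm. 1.1]).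
* scope_caveats: (a) the fact is vendored with `H₂(M; ℤ) ≅ ℤ³` in place of "`M = ℂℙ² # 2ℂℙ²bar`": the tree has oriented connected sums (`Literature.Topology.FourManifolds.IsOrientedConnectedSum`) but no distinguished (complex) orientation of `Literature.Topology.FourManifolds.ComplexProjectivePlane`, so `ℂℙ²bar` summands cannot be named; irreducibility and the symplectic member are dropped [cite: AkhmedovPark2010, Thm. 1 (i)]; (b) the frontier statement "smallest known" is dated 2007/2010 and is a statement about the literature, not a theorem [cite: AkhmedovPark2010, §1]; (c) the barrier concerns closed simply connected manifolds only; it does not say that techniques proving rigidity specifically at `b₂ = 0` must fail; (d) AUDIT 2026-08-16: nor that techniques blind to `b₂` but sensitive to the TYPE of the intersection form (parity, signature, definiteness) or to any property failing on all smooth structures of `ℂℙ² # 2ℂℙ²bar` must fail — the `BARRIERS.lean` A11 line "Kills: … a homeo⇒diffeo theorem insensitive to `b₂ ≤ 2`" is to be read "insensitive to `b₂ ≤ 2` AND to type"; the frontiers quoted in evasions_known (ii) are statements about the 2023–2024 literature, as (b) [cite: BaykurHamada2023, Thm. A] [cite: StipsiczSzabo2024, §1].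
* status: established (theorem: `smallExoticaBarrier_of_akhmedovPark` from the named fact) [cite: AkhmedovPark2010, Thm. 1 (i)]; technique class NARROWED by audit 2026-08-16 (companion `SmallExoticaFrontierNarrow.lean`) [cite: BaykurHamada2023, Thm. A] [cite: StipsiczSzabo2024, §1]

[cite: AkhmedovPark2010, Thm. 1 (i) and §1] -/
def SmallExoticaBarrier : Prop :=
  ¬ SimplyConnectedRigidityUpTo 3

/-- **`SmallExoticaBarrier` follows from Akhmedov–Park** (hypothesis `hAP`, D-0014): `N 0` and `N 1`
are homeomorphic to `M`, hence simply connected; the `H₂` hypothesis is only needed on `M`; apply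
rigidity to the pairs `(M, N 0)`, `(M, N 1)` and compose. [cite: AkhmedovPark2010, Thm. 1 (i)] -/
theorem smallExoticaBarrier_of_akhmedovPark (hAP : akhmedovPark2010_exotic_bTwo_three) :
    SmallExoticaBarrier := by
  intro h
  obtain ⟨M, _, _, _, _, _, _, _, N, _, _, _, _, _, _, ⟨hb⟩, hN, hinj⟩ := hAP
  obtain ⟨e0⟩ := hN 0
  obtain ⟨e1⟩ := hN 1
  haveI : SimplyConnectedSpace (N 0) := e0.toHomotopyEquiv.simplyConnectedSpace
  haveI : SimplyConnectedSpace (N 1) := e1.toHomotopyEquiv.simplyConnectedSpace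
  have hM : HasSecondHomologyRankLE 3 M := ⟨3, le_rfl, ⟨hb⟩⟩
  obtain ⟨d0⟩ := h M (N 0) hM ⟨e0.symm⟩
  obtain ⟨d1⟩ := h M (N 1) hM ⟨e1.symm⟩
  exact absurd (hinj 0 1 ⟨d0.symm.trans d1⟩) zero_ne_one

/-- Hence every member of the graded family with `k ≥ 3` fails. [cite: AkhmedovPark2010, Thm. 1 (i)] -/
theorem not_simplyConnectedRigidityUpTo_of_three_le (hAP : akhmedovPark2010_exotic_bTwo_three)
    {k : ℕ} (hk : 3 ≤ k) : ¬ SimplyConnectedRigidityUpTo k :=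
  fun h => smallExoticaBarrier_of_akhmedovPark hAP (h.anti hk)

end Literature.Barriers.SmoothPoincare4

end
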